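import Summits.BirchSwinnertonDyer.Uniform.U2.TransportA
import Summits.BirchSwinnertonDyer.Rank1Residual.P2.CountsAtTwoZhai16
import HarnessLib

/-!
# Track U2, route A (cell `bsd-uniform`, seat u2-p1): the RANK-ZERO member CLOSED at `2` —
# Zhai 2016 (analytic side, printed) + Mazur–Rubin 2010 control (algebraic side, printed) ⇒
# `BSD(E^{(M)}, 2)` for the a_q-odd twists, modulo odd Tamagawa numbers of the twist

HONEST FRAMING (cell `bsd-uniform`, HOME run/shared/lean/pub/bsd-uniform/, verbatim in every file of
the seat): a RELATIVE (twist-transport) theorem, uniform in the twisting parameter `M`, CONDITIONAL per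
base curve on named invariants of the base — here: `E` `Γ₀(N)`-optimal with `E[2](ℚ) = 0`, unit
`2`-adic algebraic `L`-value (`ord₂ L(E,1)/Ω_∞ = 0` for `Δ < 0`, `= 1` for `Δ > 0`: Zhai's printed
hypotheses, analytic rank `0`), and `Ш(E/ℚ)[2] = 0`. It converts PAIRS, never the class X5; it books
nothing, moves no census number, and no per-curve certificate is counted as a uniform theorem. ALL
non-kernel inputs are PUBLISHED theorems taken BY NAME: Zhai 2016 Thm. 1.1 / 1.2
(`Zhai2016.thm11_…`, `thm12_…`, typed by the p2 lane), Mazur–Rubin 2010 Cor. 3.4 (ii)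
(`MazurRubin2010.cor34ii_rat`), modularity (`hasEntireLFunction_rat`), Gross–Zagier–Kolyvagin
(`rank_eq_analyticRank_of_analyticRank_le_one`). NO Heegner field, NO Cassels–Tate here.

NEAREST PRIOR ART AND WHAT IS NEW (why this file exists). For `Δ_E < 0` Zhai 2016 prints, right
after Thm 1.1 (arXiv:1409.0231 chunk p0002 L31): "by the above theorem and the work of Boxer and Diao
[Boxer], the 2-part of Birch and Swinnerton-Dyer conjecture is valid for `L(E^{(M)},s)` … [for] `E`
… satisfying … the following further conditions: 1) The 2-Selmer rank of `E` is 0; 2) If `p` is any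
prime for which `E` has bad reduction, then `E` has multiplicative reduction at `p` and the `p`-adic
valuation of the discriminant of `E` is odd; 3) `E` has good reduction at 2 and the reduction of
`E mod 2` has `j`-invariant 0" — Boxer–Diao, PAMS 138 (2010) Thm 1.1 ("good" `E`, `d` odd square-free
"2-trivial" and prime to `Δ` ⇒ `dim Sel₂(E^{(d)}) = 0`; their Remark also records Mazur–Rubin
Prop 4.2: `Sel₂(E) = 0`, `0 < d ≡ 1 (mod 8Δ)` 2-trivial ⇒ `Sel₂(E^{(d)}) = 0`). So the `Δ < 0` theorem
below is that PRINTED REMARK made kernel-checked with Mazur–Rubin Cor 3.4 (ii) as the control input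
instead of Boxer–Diao's: the base conditions become INCOMPARABLE (here: additive primes and
even-`ord(Δ)` multiplicative primes ARE allowed provided they split in `ℚ(√M)`, any reduction at `2`
provided `M ≡ 1 (mod 8)`; there: square-free-conductor odd-`ord(Δ)` bases, good supersingular-type at
`2`, but every odd `M ≡ 1 (mod 4)`), and the Tamagawa proviso is kept EXPLICIT (`ord₂ ∏ c_ℓ(E^{(M)}) = 0`)
rather than built into "good". For `Δ_E > 0` (Thm 1.2) print only says (p0003 L46–L47) that the
valuation is "entirely consistent with the 2-part of [BSD], provided we know … that the 2-primary
subgroup of the Tate-Shafarevich group of the relevant twists is zero … it is not straightforward to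
carry out a classical 2-descent on these curves because of our hypothesis that `E[2](ℚ) = 0`" — no
BSD₂ claim is printed there; the second theorem below supplies it under the control binders. In both
cases route A supplies the `Ш` proviso WITHOUT a `2`-descent on the twist: the
`2`-Selmer rank is CONTROLLED under twist by `M` (Mazur–Rubin Cor. 3.4 (ii): the primes of `M` have
`E(ℚ_q)[2] = 0`, i.e. `a_q` odd, and the bad primes of `E` see `M` as a local square or are
odd-`ord(Δ)` multiplicative), so `Sel₂(E^{(M)}) ≅ Sel₂(E) = 0` when `rank E = 0`, `E(ℚ)[2] = 0`,
`Ш(E)[2] = 0` (`RouteATransport.routeA_rank_zero`). Hence (p2 lane's count form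
`P2.bsdp_two_twist_iff_of_zhai11/12`: `BSD(E^{(M)},2) ⟺ ord₂ #Ш(E^{(M)}) + ord₂ ∏ c_ℓ(E^{(M)}) = 0`):
**`BSD(E^{(M)}, 2)` holds iff the Tamagawa product of `E^{(M)}` is odd** — and the latter is a
reduction-type condition (Tate's algorithm: `c_q(E^{(M)}) = 1 + #{roots of the 2-division cubic mod q}
= 1` at `q ∣ M` with `a_q` odd; `c_ℓ(E^{(M)}) = c_ℓ(E)` at `ℓ ∣ N` split in `ℚ(√M)`), left as the
named binder `padicValNat 2 WM.tamagawaProduct = 0` (its discharge from printed Tate-algorithm facts is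
the residue line R-A7 in HOME/RESIDUE.md).

REDUCTION TYPES COVERED / RESIDUE: as in `RouteATransport` (MR Prop. 3.3 binders explicit below):
additive primes of `E` must split in `ℚ(√M)`, multiplicative even-`ord(Δ)` primes must split, `2`
must split (`M ≡ 1 (mod 8)`), `M > 0` when `Δ > 0` (Zhai's own sign condition, `h_∞ = 0`); residue
R-A1…R-A5, R-A7 of HOME/RESIDUE.md.

## Contents
* `padicValNat_card_eq_zero_of_primaryComponent_eq_bot` — `Ш[2^∞] = 0 ⇒ ord₂ #Ш = 0` (finite `Ш`).
* `routeA_bsdp_two_twist_iff_of_zhai11` — `Δ_E < 0` (Zhai Thm 1.1 + MR + route A).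
* `routeA_bsdp_two_twist_iff_of_zhai12` — `Δ_E > 0`, `M > 0` (Zhai Thm 1.2 + MR + route A).

References: S. Zhai, Asian J. Math. 20 (2016) Thm. 1.1, 1.2 and the remarks after Thm 1.1 / Thm 1.2
[Zhai2016]; G. Boxer, P. Diao, Proc. AMS 138 (2010) 1969–1978, Thm. 1.1 / Thm. 2.1 [BoxerDiao2010]
(nearest prior art for the `Δ < 0` half); Mazur–Rubin, Invent. Math. 181 (2010) Cor. 3.4 (ii) and
Prop. 4.2 [MazurRubin2010]; Miller 2011 Def. 1.1 [Miller2011LMS]; p2 lane `P2/CountsAtTwoZhai16.lean`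
(count form) and `P2/TwistInvarianceAtTwo.lean`.
-/

noncomputable section

open scoped Classical AddSubgroup

open NumberField WeierstrassCurve Literature.NumberTheory.EllipticCurves
  Literature.NumberTheory.EllipticCurves.ModularForms
  Literature.NumberTheory.EllipticCurves.Rank1Residual
  Literature.NumberTheory.EllipticCurves.CoatesLiTianZhai2015
  Literature.NumberTheory.EllipticCurves.Zhai2016
  Summit.BirchSwinnertonDyer.Rank1Residual

namespace Summit.BirchSwinnertonDyer.Uniform.U2

/-! ## §1 `Ш[2^∞] = 0 ⇒ ord₂ #Ш = 0` -/

/-- For a finite abelian group `A` with trivial `2`-primary component, `ord₂ #A = 0`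
(`#A(2) = 2^{ord₂ #A}`, tree `padicValNat_card_addPrimaryComponent`). [folklore] -/
theorem padicValNat_card_eq_zero_of_primaryComponent_eq_bot {A : Type*} [AddCommGroup A] [Finite A]
    (p : ℕ) [Fact p.Prime] (h : AddCommGroup.primaryComponent A p = ⊥) :
    padicValNat p (Nat.card A) = 0 := by
  rw [← padicValNat_card_addPrimaryComponent (A := A) p, h, AddSubgroup.card_bot]
  simp

/-! ## §2 The rank-zero member closed at `2`, modulo odd Tamagawa numbers -/

section RankZero

variable {W : WeierstrassCurve ℚ} [W.IsElliptic] [W.IsGloballyMinimal] [NeZero (W.conductorNorm ℤ)]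

omit [W.IsGloballyMinimal] [NeZero (W.conductorNorm ℤ)] in
/-- From Zhai's base hypotheses: `L(E,1) ≠ 0`, so `r_an(E) = 0` and (GZK) `rank E(ℚ) = 0`;
and `#E(ℚ)[2] = 1` gives `E(ℚ)[2] = ⊥`. Bookkeeping. [cite: Zhai2016, Thm. 1.1 (hypotheses)] -/
theorem base_rank_zero_and_torsionBy_two_eq_bot (hmod : hasEntireLFunction_rat)
    (hGZK : rank_eq_analyticRank_of_analyticRank_le_one)
    (h1 : Nat.card {P : W.toAffine.Point // (2 : ℕ) • P = 0} = 1)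
    {x : ℚ} (hx : IsLAlg W x) (hx0 : x ≠ 0) :
    W.mordellWeilRank = 0 ∧ W.toAffine.Point[(2 : ℤ)] = ⊥ := by
  have hcpos := WeierstrassCurve.numRealComponents_pos (W.baseChange ℝ)
  have hOmega : leastRealPeriod W ≠ 0 := by
    unfold leastRealPeriod
    exact div_ne_zero W.realPeriodRat_pos_holds.ne' (by exact_mod_cast hcpos.ne')
  have hLne : W.entireLFunction 1 ≠ 0 := entireLFunction_one_ne_zero_of_isLAlg hx hx0 hOmega
  have hr : W.analyticRank = 0 := (W.analyticRank_eq_zero_iff_holds (hmod W)).2 hLne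
  have hrank : W.mordellWeilRank = 0 := by
    have := (hGZK W (by omega)).1
    omega
  refine ⟨hrank, torsionBy_two_eq_bot_iff.mpr ?_⟩
  exact (X5.O1.irr_two_iff_forall_two_nsmul W).mp (P2.irr_two_of_card_twoTorsion_eq_one W h1)

/-- **ROUTE A, RANK-ZERO MEMBER CLOSED AT `2` (Zhai 2016 Thm 1.1 ∘ Mazur–Rubin 2010 Cor 3.4 (ii)).**
`E/ℚ` `Γ₀(N)`-optimal (globally minimal `W`, datum `Dt` with the lattice equality) with `Δ_E < 0`,
`E[2](ℚ) = 0`, `ord₂(L(E,1)/Ω_∞(E)) = 0` and `Ш(E/ℚ)[2] = 0`; `F₃` the cubic `2`-division field; `M`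
square-free, `M ≡ 1 (mod 4)`, `M ≠ 1`, `(M, N) = 1`, every prime factor odd and inert in `F₃` (= `a_q`
odd); `F₂ = ℚ(√M)` with the CONTROL binders of Mazur–Rubin Prop. 3.3 over `ℚ` (additive primes of `E`
split in `F₂`; multiplicative even-`ord(Δ)` primes split; `2` splits; odd-`ord(Δ)` multiplicative
primes unramified; every prime ramified in `F₂` has `E(ℚ_q)[2] = 0`); `WM` a globally minimal model of
`E^{(M)}`. THEN: `r_an(E^{(M)}) = 0`, `rank E^{(M)}(ℚ) = 0`, `Ш(E^{(M)}/ℚ)[2^∞] = 0`, and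
**`BSD(E^{(M)}, 2) ⟺ ord₂ ∏_ℓ c_ℓ(E^{(M)}) = 0`**. Inputs by name: Zhai Thm 1.1 (`h11`), MR Cor 3.4 (ii)
(`hMR`), modularity (`hmod`), GZK (`hGZK`). No Heegner field, no Cassels–Tate. Nearest print: Zhai's
remark after Thm 1.1 with Boxer–Diao 2010 Thm 1.1 (square-free odd-`ord(Δ)` conductor, good at `2` with
`j ≡ 0 (2)`, `Sel₂(E) = 0`, any odd `M`); here the control input is Mazur–Rubin's (incomparable base
class, `M ≡ 1 (8)`).
[cite: Zhai2016, Thm. 1.1 and the remark after it (arXiv:1409.0231 chunk p0002 L22–L31)]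
[cite: BoxerDiao2010, Thm. 1.1 and Thm. 2.1 (nearest prior art)]
[cite: MazurRubin2010, Cor. 3.4 (ii) with Prop. 3.3] [cite: Miller2011LMS, Def. 1.1] -/
theorem routeA_bsdp_two_twist_iff_of_zhai11 (h11 : thm11_ordTwo_LAlg_twist_eq_zero)
    (hMR : MazurRubin2010.cor34ii_rat) (hmod : hasEntireLFunction_rat)
    (hGZK : rank_eq_analyticRank_of_analyticRank_le_one)
    (Dt : ModularParametrizationData W (W.conductorNorm ℤ)) (hopt : Zhai2021.IsOptimalDatum W Dt)
    (hΔ : W.Δ < 0) (h1 : Nat.card {P : W.toAffine.Point // (2 : ℕ) • P = 0} = 1)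
    (hL : ∃ x : ℚ, IsLAlg W x ∧ x ≠ 0 ∧ padicValRat 2 x = 0) (hWsha : (W.sha)[(2 : ℤ)] = ⊥)
    (F₃ : Type) [Field F₃] [NumberField F₃] (hF₃ : IsTwoDivisionField W F₃)
    (M : ℤ) (hsq : Squarefree M) (hM4 : M % 4 = 1) (hM1 : M ≠ 1)
    (hgcd : Int.gcd M (W.conductorNorm ℤ) = 1) (hne : M.natAbs.primeFactors.Nonempty)
    (hin : ∀ q ∈ M.natAbs.primeFactors, q ≠ 2 ∧ IsInertIn F₃ q)
    -- Mazur–Rubin control binders for `F₂ = ℚ(√M)`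
    (F₂ : Type) [Field F₂] [NumberField F₂] (hF₂ : Module.finrank ℚ F₂ = 2)
    (hxM : ∃ y : F₂, y ^ 2 = (M : F₂))
    (hadd : ∀ (p : ℕ) [Fact p.Prime], ¬ W.HasGoodReductionAtPrime p →
      ¬ W.HasMultiplicativeReductionAtPrime p → ((Ideal.span {(p : ℤ)}).primesOver (𝓞 F₂)).ncard = 2)
    (hmev : ∀ (p : ℕ) [Fact p.Prime], W.HasMultiplicativeReductionAtPrime p →
      Even (padicValRat p W.Δ) → ((Ideal.span {(p : ℤ)}).primesOver (𝓞 F₂)).ncard = 2)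
    (h2 : ((Ideal.span {(2 : ℤ)}).primesOver (𝓞 F₂)).ncard = 2)
    (hmodd : ∀ (p : ℕ) [Fact p.Prime], W.HasMultiplicativeReductionAtPrime p →
      Odd (padicValRat p W.Δ) → ¬ (p : ℤ) ∣ NumberField.discr F₂)
    (hT : ∀ (p : ℕ) [Fact p.Prime], (p : ℤ) ∣ NumberField.discr F₂ →
      ∀ Q : (W.baseChange ℚ_[p]).toAffine.Point, 2 • Q = 0 → Q = 0)
    {WM : WeierstrassCurve ℚ} [WM.IsElliptic] [WM.IsGloballyMinimal]
    (hWM : ∃ C : VariableChange ℚ, C • W.quadraticTwist (M : ℚ) = WM) :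
    WM.analyticRank = 0 ∧ WM.mordellWeilRank = 0 ∧ AddCommGroup.primaryComponent WM.sha 2 = ⊥ ∧
      (BSDp WM 2 ↔ padicValNat 2 WM.tamagawaProduct = 0) := by
  -- Zhai (analytic side) in the p2 lane's count form
  obtain ⟨hr, hiff⟩ := P2.bsdp_two_twist_iff_of_zhai11 h11 hmod Dt hopt hΔ h1 hL F₃ hF₃ M hsq hM4
    hgcd hne hin hWM
  obtain ⟨-, -, -, hfinSha⟩ := h11 W Dt hopt hΔ h1 hL F₃ hF₃ M hsq hM4 hgcd hne hin WM hWM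
  haveI := hfinSha
  -- base data
  obtain ⟨x, hx, hx0, -⟩ := hL
  obtain ⟨hrank, hW2⟩ := base_rank_zero_and_torsionBy_two_eq_bot hmod hGZK h1 hx hx0
  -- route A, rank-zero case (MR control; `Δ < 0` makes the real-place binder vacuous)
  have hreal : 0 < W.Δ → NumberField.IsTotallyReal F₂ := fun h => absurd h (not_lt.mpr hΔ.le)
  obtain ⟨hrM, -, hshaM⟩ := routeA_rank_zero W hMR hsq hM1 F₂ hF₂ hxM hadd hmev h2 hreal hmodd hT
    hW2 hWsha hrank WM (P2.exists_smul_eq_comm.mp hWM)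
  refine ⟨hr, hrM, hshaM, hiff.trans ?_⟩
  rw [padicValNat_card_eq_zero_of_primaryComponent_eq_bot 2 hshaM]
  omega

/-- **ROUTE A, RANK-ZERO MEMBER CLOSED AT `2`, positive discriminant (Zhai 2016 Thm 1.2 ∘ Mazur–Rubin
2010 Cor 3.4 (ii)).** As the previous theorem with `Δ_E > 0`, `ord₂(L(E,1)/Ω_∞(E)) = 1`, `M > 0`
(Zhai's sign condition = `h_∞ = 0`) and `F₂ = ℚ(√M)` real. THEN `r_an(E^{(M)}) = 0`,
`rank E^{(M)}(ℚ) = 0`, `Ш(E^{(M)}/ℚ)[2^∞] = 0`, and `BSD(E^{(M)}, 2) ⟺ ord₂ ∏_ℓ c_ℓ(E^{(M)}) = 0`.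
[cite: Zhai2016, Thm. 1.2 and p. 477 remark (arXiv:1409.0231 chunk p0003 L11–L18, L46–L47)]
[cite: MazurRubin2010, Cor. 3.4 (ii) with Prop. 3.3] [cite: Miller2011LMS, Def. 1.1] -/
theorem routeA_bsdp_two_twist_iff_of_zhai12 (h12 : thm12_ordTwo_LAlg_twist_eq_one)
    (hMR : MazurRubin2010.cor34ii_rat) (hmod : hasEntireLFunction_rat)
    (hGZK : rank_eq_analyticRank_of_analyticRank_le_one)
    (Dt : ModularParametrizationData W (W.conductorNorm ℤ)) (hopt : Zhai2021.IsOptimalDatum W Dt)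
    (hΔ : 0 < W.Δ) (h1 : Nat.card {P : W.toAffine.Point // (2 : ℕ) • P = 0} = 1)
    (hL : ∃ x : ℚ, IsLAlg W x ∧ x ≠ 0 ∧ padicValRat 2 x = 1) (hWsha : (W.sha)[(2 : ℤ)] = ⊥)
    (F₃ : Type) [Field F₃] [NumberField F₃] (hF₃ : IsTwoDivisionField W F₃)
    (M : ℤ) (hMpos : 0 < M) (hsq : Squarefree M) (hM4 : M % 4 = 1) (hM1 : M ≠ 1)
    (hgcd : Int.gcd M (W.conductorNorm ℤ) = 1) (hne : M.natAbs.primeFactors.Nonempty)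
    (hin : ∀ q ∈ M.natAbs.primeFactors, q ≠ 2 ∧ IsInertIn F₃ q)
    (F₂ : Type) [Field F₂] [NumberField F₂] (hF₂ : Module.finrank ℚ F₂ = 2)
    (hxM : ∃ y : F₂, y ^ 2 = (M : F₂)) (hreal : NumberField.IsTotallyReal F₂)
    (hadd : ∀ (p : ℕ) [Fact p.Prime], ¬ W.HasGoodReductionAtPrime p →
      ¬ W.HasMultiplicativeReductionAtPrime p → ((Ideal.span {(p : ℤ)}).primesOver (𝓞 F₂)).ncard = 2)
    (hmev : ∀ (p : ℕ) [Fact p.Prime], W.HasMultiplicativeReductionAtPrime p →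
      Even (padicValRat p W.Δ) → ((Ideal.span {(p : ℤ)}).primesOver (𝓞 F₂)).ncard = 2)
    (h2 : ((Ideal.span {(2 : ℤ)}).primesOver (𝓞 F₂)).ncard = 2)
    (hmodd : ∀ (p : ℕ) [Fact p.Prime], W.HasMultiplicativeReductionAtPrime p →
      Odd (padicValRat p W.Δ) → ¬ (p : ℤ) ∣ NumberField.discr F₂)
    (hT : ∀ (p : ℕ) [Fact p.Prime], (p : ℤ) ∣ NumberField.discr F₂ →
      ∀ Q : (W.baseChange ℚ_[p]).toAffine.Point, 2 • Q = 0 → Q = 0)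
    {WM : WeierstrassCurve ℚ} [WM.IsElliptic] [WM.IsGloballyMinimal]
    (hWM : ∃ C : VariableChange ℚ, C • W.quadraticTwist (M : ℚ) = WM) :
    WM.analyticRank = 0 ∧ WM.mordellWeilRank = 0 ∧ AddCommGroup.primaryComponent WM.sha 2 = ⊥ ∧
      (BSDp WM 2 ↔ padicValNat 2 WM.tamagawaProduct = 0) := by
  obtain ⟨hr, hiff⟩ := P2.bsdp_two_twist_iff_of_zhai12 h12 hmod Dt hopt hΔ h1 hL F₃ hF₃ M hMpos hsq
    hM4 hgcd hne hin hWM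
  obtain ⟨-, -, -, hfinSha⟩ := h12 W Dt hopt hΔ h1 hL F₃ hF₃ M hMpos hsq hM4 hgcd hne hin WM hWM
  haveI := hfinSha
  obtain ⟨x, hx, hx0, -⟩ := hL
  obtain ⟨hrank, hW2⟩ := base_rank_zero_and_torsionBy_two_eq_bot hmod hGZK h1 hx hx0
  obtain ⟨hrM, -, hshaM⟩ := routeA_rank_zero W hMR hsq hM1 F₂ hF₂ hxM hadd hmev h2 (fun _ => hreal)
    hmodd hT hW2 hWsha hrank WM (P2.exists_smul_eq_comm.mp hWM)
  refine ⟨hr, hrM, hshaM, hiff.trans ?_⟩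
  rw [padicValNat_card_eq_zero_of_primaryComponent_eq_bot 2 hshaM]
  omega

end RankZero

end Summit.BirchSwinnertonDyer.Uniform.U2

end
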